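import Literature.AnabelianGeometry.EtaleTheta.ThetaSettingHatTheta
import Literature.AnabelianGeometry.EtaleTheta.TemperedRigidity
import Literature.AnabelianGeometry.SemiGraphs.TemperedCompletionExtension
import HarnessLib

/-!
# [EtTh] Rmk. 1.6.4 (c3) / [SemiAnbd] Thm. 6.4: the HAT COMPANION `ê : ((Π^tp_{Xα})^Θ)^∧ ⥲ ((Π^tp_{Xβ})^Θ)^∧` of an
# isomorphism of tempered theta quotients — profinite completions of isomorphic groups are isomorphic, uniquely

S. Mochizuki, *The Étale Theta Function …* [EtTh], Publ. RIMS **45** (2009), Remark 1.6.4, PDF p. 26–27 (PRIMS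
pp. 252–253): "if we denote by `(Ÿ^log)^∧ → (Y^log)^∧ → X^log` the profinite étale coverings determined by the tempered
coverings … then the set of classes … determines, by profinite completion, a set of classes … Moreover, given `Xα`, `Xβ`
as in Theorem 1.6, any isomorphism `Π_{Xα} ⥲ Π_{Xβ}` preserves these profinite étale theta functions"
[cite: MochizukiEtTh2009, Rmk 1.6.4 p.26]; S. Mochizuki, *Semi-graphs of anabelioids* [SemiAnbd], Publ. RIMS **42**
(2006), proof of Thm. 6.4 p. 71: "profinite completion yields `φ̂ : Π_{X_K} → Π_{Y_L}`" [cite: MochizukiSemiAnbd2006, Thm 6.4 proof p.71].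

Layer L2 of the abc-iut cell, seat abc-iut-f-142 gen 8, row «HAT-COMPANION ê FROM γ» (abc-iut-L2-lead gen 9, ROWS #160
R1313).  abc-iut-w6-d081's Rmk. 1.6.4 (c3) transport file (D5 (5b)) displays, besides `γ : Π^tp_α ⥲ Π^tp_β` and a
theta companion `c` (abc-iut-L2-t1's `ThetaCompanion γ`, `c.thetaIso : (Π^tp_α)^Θ ≃ₜ* (Π^tp_β)^Θ`), a HAT COMPANION
`ê : GhatTheta_α ≃ₜ* GhatTheta_β` with `ê ∘ ι_α = ι_β ∘ c.thetaIso` as a HYPOTHESIS.  This file CONSTRUCTS it — so that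
binder is struck — from the universal property of abc-iut-L3's `IsProfiniteCompletion` already in the tree
(abc-iut-w5-d139's `IsProfiniteCompletion.exists_extension` / `extension_unique`, `TemperedCompletionExtension.lean`):

* §1 GENERIC (namespace `SemiGraphs.IsProfiniteCompletion`): `lift hι ψ : F̂ →ₜ* P` (THE extension of a continuous
  `ψ : F → P` into a profinite `P` along a profinite completion `ι : F → F̂`; `lift_ι`, `lift_unique`), and
  **`equivOfEquiv hα hβ θ : F̂α ≃ₜ* F̂β`** for profinite completions `ια`, `ιβ` and `θ : Fα ≃ₜ* Fβ` (the lifts of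
  `ιβ ∘ θ` and `ια ∘ θ⁻¹`, mutually inverse by uniqueness + density), with `equivOfEquiv_ι : ê (ια x) = ιβ (θ x)`,
  `equivOfEquiv_symm_ι`, and `equivOfEquiv_unique` (ANY continuous homomorphism `F̂α → F̂β` over `θ` is `ê`);
* §2 AT THE RECORD (namespace `ThetaSetting.HatTheta`): **`companion Tα Tβ θ : Tα.GhatTheta ≃ₜ* Tβ.GhatTheta`** for
  `θ : Dα.GtpTheta ≃ₜ* Dβ.GtpTheta`, `companion_ι`, `companion_symm_ι`, `companion_unique`; for a theta companion `c` of
  `γ`: `companion_ι_toTheta : ê (Tα.ι ((·)^Θ x)) = Tβ.ι ((·)^Θ (γ x))`; and, with `hatIso γ : Π_{Xα} ≃ₜ* Π_{Xβ}` the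
  completion of `γ` itself (`equivOfEquiv` of the two `toHat`), the PROFINITE square
  `companion_toThetaHat : ê (Tα.toThetaHat y) = Tβ.toThetaHat (hatIso γ y)` (uniqueness on the dense `toHat(Π^tp_{Xα})`).

DEF-BEARING (`lift`, `equivOfEquiv`, `companion`, `hatIso`); no instance, no notation, no `Prop`-fact; nothing of [EtTh]
Rmk. 1.6.4 is asserted (the file supplies an INPUT of its (c3) clause); no side is taken on [IUTchIII] Cor. 3.12; nothing
here asserts that abc is proved or refuted; typed ≠ proved.
-/

noncomputable section

/-! ### §1. Generic: lifting along a profinite completion, and the completion of an isomorphism -/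

namespace Literature.AnabelianGeometry.SemiGraphs

namespace IsProfiniteCompletion

open Topology

universe u v w u' v'

section Lift

variable {F : Type u} {Fhat : Type v} [Group F] [TopologicalSpace F]
  [Group Fhat] [TopologicalSpace Fhat] [IsTopologicalGroup Fhat] {ι : F →ₜ* Fhat}
  {P : Type w} [Group P] [TopologicalSpace P] [IsTopologicalGroup P] [CompactSpace P]
  [TotallyDisconnectedSpace P]

/-- **The lift `ψ̂ : F̂ → P`** of a continuous homomorphism `ψ : F → P` into a profinite group along a profinite
completion `ι : F → F̂` (a CHOICE of the extension of abc-iut-w5-d139's `exists_extension`; unique by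
`extension_unique`) — "profinite completion yields `φ̂`" ([SemiAnbd] Thm. 6.4, proof p. 71).
[cite: MochizukiSemiAnbd2006, Thm 6.4 proof p.71] -/
def lift (hι : IsProfiniteCompletion ι) (ψ : F →ₜ* P) : Fhat →ₜ* P :=
  Classical.choose (hι.exists_extension ψ)

/-- `ψ̂ ∘ ι = ψ`. [cite: MochizukiSemiAnbd2006, Thm 6.4 proof p.71] -/
theorem lift_ι (hι : IsProfiniteCompletion ι) (ψ : F →ₜ* P) (x : F) : hι.lift ψ (ι x) = ψ x :=
  Classical.choose_spec (hι.exists_extension ψ) x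

omit [IsTopologicalGroup Fhat] [IsTopologicalGroup P] [CompactSpace P] [TotallyDisconnectedSpace P] in
/-- Uniqueness of the lift among continuous homomorphisms `F̂ → P` (`P` Hausdorff): any `Φ` with `Φ ∘ ι = ψ` is
determined (abc-iut-w5-d139's `extension_unique`, pointwise form). [cite: MochizukiSemiAnbd2006, Thm 6.4 proof p.71] -/
theorem eq_of_apply_ι_eq [T2Space P] (hι : IsProfiniteCompletion ι) (Φ Ψ : Fhat →ₜ* P)
    (h : ∀ x : F, Φ (ι x) = Ψ (ι x)) (y : Fhat) : Φ y = Ψ y := by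
  rw [extension_unique hι Φ Ψ h]

/-- `Φ ∘ ι = ψ ⇒ Φ = ψ̂`. [cite: MochizukiSemiAnbd2006, Thm 6.4 proof p.71] -/
theorem lift_unique (hι : IsProfiniteCompletion ι) (ψ : F →ₜ* P) (Φ : Fhat →ₜ* P)
    (h : ∀ x : F, Φ (ι x) = ψ x) : Φ = hι.lift ψ :=
  haveI : T2Space P := inferInstance
  extension_unique hι Φ (hι.lift ψ) fun x => by rw [h, lift_ι]

end Lift

section EquivOfEquiv

variable {Fα : Type u} {Fhatα : Type v} {Fβ : Type u'} {Fhatβ : Type v'}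
  [Group Fα] [TopologicalSpace Fα] [Group Fhatα] [TopologicalSpace Fhatα] [IsTopologicalGroup Fhatα]
  [Group Fβ] [TopologicalSpace Fβ] [Group Fhatβ] [TopologicalSpace Fhatβ] [IsTopologicalGroup Fhatβ]
  {ια : Fα →ₜ* Fhatα} {ιβ : Fβ →ₜ* Fhatβ}

/-- The underlying forward homomorphism of `equivOfEquiv`: the lift of `ιβ ∘ θ` along `ια`.
[cite: MochizukiSemiAnbd2006, Thm 6.4 proof p.71] -/
def equivOfEquivHom (hα : IsProfiniteCompletion ια) (hβ : IsProfiniteCompletion ιβ) (θ : Fα ≃ₜ* Fβ) :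
    Fhatα →ₜ* Fhatβ :=
  haveI : CompactSpace Fhatβ := hβ.compactSpace
  haveI : TotallyDisconnectedSpace Fhatβ := hβ.totallyDisconnectedSpace
  hα.lift (ιβ.comp (θ : Fα →ₜ* Fβ))

/-- `equivOfEquivHom (ια x) = ιβ (θ x)`. [cite: MochizukiSemiAnbd2006, Thm 6.4 proof p.71] -/
theorem equivOfEquivHom_ι (hα : IsProfiniteCompletion ια) (hβ : IsProfiniteCompletion ιβ) (θ : Fα ≃ₜ* Fβ)
    (x : Fα) : equivOfEquivHom hα hβ θ (ια x) = ιβ (θ x) := by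
  haveI : CompactSpace Fhatβ := hβ.compactSpace
  haveI : TotallyDisconnectedSpace Fhatβ := hβ.totallyDisconnectedSpace
  exact hα.lift_ι _ x

/-- The two lifts are mutually inverse (uniqueness of extensions on the dense images).
[cite: MochizukiSemiAnbd2006, Thm 6.4 proof p.71] -/
theorem equivOfEquivHom_symm_comp (hα : IsProfiniteCompletion ια) (hβ : IsProfiniteCompletion ιβ)
    (θ : Fα ≃ₜ* Fβ) (y : Fhatα) :
    equivOfEquivHom hβ hα θ.symm (equivOfEquivHom hα hβ θ y) = y := by
  haveI : T2Space Fhatα := hα.t2Space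
  have h := eq_of_apply_ι_eq hα ((equivOfEquivHom hβ hα θ.symm).comp (equivOfEquivHom hα hβ θ))
    (ContinuousMonoidHom.id Fhatα) (fun x => by
      change equivOfEquivHom hβ hα θ.symm (equivOfEquivHom hα hβ θ (ια x)) = ια x
      rw [equivOfEquivHom_ι, equivOfEquivHom_ι, ContinuousMulEquiv.symm_apply_apply]) y
  exact h

/-- **The completion of an isomorphism**: for profinite completions `ια : Fα → F̂α`, `ιβ : Fβ → F̂β` and an isomorphism
of topological groups `θ : Fα ⥲ Fβ`, THE isomorphism `ê : F̂α ⥲ F̂β` with `ê ∘ ια = ιβ ∘ θ` ("profinite completion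
yields `φ̂`", [SemiAnbd] Thm. 6.4 proof p. 71 — here for an isomorphism, with inverse the completion of `θ⁻¹`).
[cite: MochizukiSemiAnbd2006, Thm 6.4 proof p.71] -/
def equivOfEquiv (hα : IsProfiniteCompletion ια) (hβ : IsProfiniteCompletion ιβ) (θ : Fα ≃ₜ* Fβ) :
    Fhatα ≃ₜ* Fhatβ where
  toFun := equivOfEquivHom hα hβ θ
  invFun := equivOfEquivHom hβ hα θ.symm
  left_inv y := equivOfEquivHom_symm_comp hα hβ θ y
  right_inv z := by
    have h := equivOfEquivHom_symm_comp hβ hα θ.symm z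
    rwa [ContinuousMulEquiv.symm_symm] at h
  map_mul' y y' := map_mul (equivOfEquivHom hα hβ θ) y y'
  continuous_toFun := (equivOfEquivHom hα hβ θ).continuous
  continuous_invFun := (equivOfEquivHom hβ hα θ.symm).continuous

/-- `ê (ια x) = ιβ (θ x)` — the completion of `θ` extends `θ`. [cite: MochizukiSemiAnbd2006, Thm 6.4 proof p.71] -/
theorem equivOfEquiv_ι (hα : IsProfiniteCompletion ια) (hβ : IsProfiniteCompletion ιβ) (θ : Fα ≃ₜ* Fβ) (x : Fα) :
    equivOfEquiv hα hβ θ (ια x) = ιβ (θ x) :=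
  equivOfEquivHom_ι hα hβ θ x

/-- `ê⁻¹ (ιβ y) = ια (θ⁻¹ y)`. [cite: MochizukiSemiAnbd2006, Thm 6.4 proof p.71] -/
theorem equivOfEquiv_symm_ι (hα : IsProfiniteCompletion ια) (hβ : IsProfiniteCompletion ιβ) (θ : Fα ≃ₜ* Fβ)
    (y : Fβ) : (equivOfEquiv hα hβ θ).symm (ιβ y) = ια (θ.symm y) :=
  equivOfEquivHom_ι hβ hα θ.symm y

/-- **Uniqueness**: any continuous homomorphism `Φ : F̂α → F̂β` with `Φ ∘ ια = ιβ ∘ θ` IS `ê` (pointwise).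
[cite: MochizukiSemiAnbd2006, Thm 6.4 proof p.71] -/
theorem equivOfEquiv_unique (hα : IsProfiniteCompletion ια) (hβ : IsProfiniteCompletion ιβ) (θ : Fα ≃ₜ* Fβ)
    (Φ : Fhatα →ₜ* Fhatβ) (h : ∀ x : Fα, Φ (ια x) = ιβ (θ x)) (y : Fhatα) :
    Φ y = equivOfEquiv hα hβ θ y := by
  haveI : T2Space Fhatβ := hβ.t2Space
  exact eq_of_apply_ι_eq hα Φ (equivOfEquivHom hα hβ θ) (fun x => by rw [h, equivOfEquivHom_ι]) y

end EquivOfEquiv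

end IsProfiniteCompletion

end Literature.AnabelianGeometry.SemiGraphs

/-! ### §2. At the record: the hat companion of an isomorphism of tempered theta quotients -/

namespace Literature.AnabelianGeometry.EtaleTheta

namespace ThetaSetting

open Literature.AnabelianGeometry.SemiGraphs

variable {p : ℕ} [Fact p.Prime] {Dα Dβ : ThetaSetting p}

/-- **The completion `γ̂ : Π_{Xα} ⥲ Π_{Xβ}` of an isomorphism `γ : Π^tp_{Xα} ⥲ Π^tp_{Xβ}`** ("the profinite étale
coverings determined by the tempered coverings", Rmk. 1.6.4; [SemiAnbd] Thm. 6.4 "profinite completion yields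
`φ̂`"): `equivOfEquiv` of the two profinite completions `toHat`. [cite: MochizukiEtTh2009, Rmk 1.6.4 p.26] -/
def hatIso (γ : Dα.PiTemp ≃ₜ* Dβ.PiTemp) : Dα.PiHat ≃ₜ* Dβ.PiHat :=
  IsProfiniteCompletion.equivOfEquiv Dα.isProfiniteCompletion_toHat Dβ.isProfiniteCompletion_toHat γ

/-- `γ̂ (toHat x) = toHat (γ x)`. [cite: MochizukiEtTh2009, Rmk 1.6.4 p.26] -/
theorem hatIso_toHat (γ : Dα.PiTemp ≃ₜ* Dβ.PiTemp) (x : Dα.PiTemp) : hatIso γ (Dα.toHat x) = Dβ.toHat (γ x) :=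
  IsProfiniteCompletion.equivOfEquiv_ι _ _ γ x

namespace HatTheta

variable (Tα : Dα.HatTheta) (Tβ : Dβ.HatTheta)

/-- **The hat companion `ê : ((Π^tp_{Xα})^Θ)^∧ ⥲ ((Π^tp_{Xβ})^Θ)^∧` of an isomorphism `θ` of tempered theta
quotients** — the completion of `θ` along the two profinite completions `ι` of the records (CONSTRUCTED, not
assumed: the displayed «hat companion» input of the Rmk. 1.6.4 (c3) transport).
[cite: MochizukiEtTh2009, Rmk 1.6.4 p.26] -/
def companion (θ : Dα.GtpTheta ≃ₜ* Dβ.GtpTheta) : Tα.GhatTheta ≃ₜ* Tβ.GhatTheta :=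
  IsProfiniteCompletion.equivOfEquiv Tα.isProfiniteCompletion_ι Tβ.isProfiniteCompletion_ι θ

/-- `ê (ια x) = ιβ (θ x)` — «`ê ∘ ι_α = ι_β ∘ γ^Θ`». [cite: MochizukiEtTh2009, Rmk 1.6.4 p.26] -/
theorem companion_ι (θ : Dα.GtpTheta ≃ₜ* Dβ.GtpTheta) (x : Dα.GtpTheta) :
    companion Tα Tβ θ (Tα.ι x) = Tβ.ι (θ x) :=
  IsProfiniteCompletion.equivOfEquiv_ι _ _ θ x

/-- `ê⁻¹ (ιβ y) = ια (θ⁻¹ y)`. [cite: MochizukiEtTh2009, Rmk 1.6.4 p.26] -/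
theorem companion_symm_ι (θ : Dα.GtpTheta ≃ₜ* Dβ.GtpTheta) (y : Dβ.GtpTheta) :
    (companion Tα Tβ θ).symm (Tβ.ι y) = Tα.ι (θ.symm y) :=
  IsProfiniteCompletion.equivOfEquiv_symm_ι _ _ θ y

/-- **Uniqueness of the hat companion**: any continuous homomorphism `Tα.GhatTheta → Tβ.GhatTheta` over `θ` is `ê`.
[cite: MochizukiEtTh2009, Rmk 1.6.4 p.26] -/
theorem companion_unique (θ : Dα.GtpTheta ≃ₜ* Dβ.GtpTheta) (Φ : Tα.GhatTheta →ₜ* Tβ.GhatTheta)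
    (h : ∀ x : Dα.GtpTheta, Φ (Tα.ι x) = Tβ.ι (θ x)) (y : Tα.GhatTheta) : Φ y = companion Tα Tβ θ y :=
  IsProfiniteCompletion.equivOfEquiv_unique _ _ θ Φ h y

/-- For a THETA COMPANION `c` of `γ : Π^tp_{Xα} ⥲ Π^tp_{Xβ}` (abc-iut-L2-t1's `ThetaCompanion`): the hat companion of
`c.thetaIso` lies over `γ` through the quotient maps — `ê (ια (x^Θ)) = ιβ ((γ x)^Θ)`.
[cite: MochizukiEtTh2009, Rmk 1.6.4 p.26] -/
theorem companion_ι_toTheta {γ : Dα.PiTemp ≃ₜ* Dβ.PiTemp} (c : ThetaCompanion γ) (x : Dα.PiTemp) :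
    companion Tα Tβ c.thetaIso (Tα.ι (Dα.toTheta x)) = Tβ.ι (Dβ.toTheta (γ x)) := by
  rw [companion_ι]
  congr 1
  exact (c.comm x).symm

/-- **The profinite square**: for a theta companion `c` of `γ`, the hat companion is compatible with the quotient maps
`toThetaHat` and the completion `γ̂ = hatIso γ` of `γ` — `ê ∘ toThetaHat_α = toThetaHat_β ∘ γ̂` (both sides are
continuous homomorphisms `Π_{Xα} → ((Π^tp_{Xβ})^Θ)^∧` agreeing on the dense `toHat(Π^tp_{Xα})`).
[cite: MochizukiEtTh2009, Rmk 1.6.4 p.26] -/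
theorem companion_toThetaHat {γ : Dα.PiTemp ≃ₜ* Dβ.PiTemp} (c : ThetaCompanion γ) (y : Dα.PiHat) :
    companion Tα Tβ c.thetaIso (Tα.toThetaHat y) = Tβ.toThetaHat (hatIso γ y) := by
  haveI : T2Space Tβ.GhatTheta := Tβ.isProfiniteCompletion_ι.t2Space
  refine IsProfiniteCompletion.eq_of_apply_ι_eq Dα.isProfiniteCompletion_toHat
    (((companion Tα Tβ c.thetaIso : Tα.GhatTheta ≃ₜ* Tβ.GhatTheta) : Tα.GhatTheta →ₜ* Tβ.GhatTheta).comp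
      Tα.toThetaHat)
    (Tβ.toThetaHat.comp ((hatIso γ : Dα.PiHat ≃ₜ* Dβ.PiHat) : Dα.PiHat →ₜ* Dβ.PiHat)) (fun x => ?_) y
  change companion Tα Tβ c.thetaIso (Tα.toThetaHat (Dα.toHat x)) = Tβ.toThetaHat (hatIso γ (Dα.toHat x))
  rw [← Tα.ι_toTheta, companion_ι_toTheta, hatIso_toHat, Tβ.ι_toTheta]

end HatTheta

end ThetaSetting

end Literature.AnabelianGeometry.EtaleTheta

end
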